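import Summits.HubbardSuperconductivity.HubbardSuperconductivity.Theorems.SoloBlindPairTower
import Summits.HubbardSuperconductivity.HubbardSuperconductivity.Theorems.SoloBlindPairFieldLocality
import Summits.HubbardSuperconductivity.HubbardSuperconductivity.Theorems.SoloBlindOrderNotEnergyRobust
import Summits.HubbardSuperconductivity.HubbardSuperconductivity.Theorems.SoloBlindPairChemicalPotential
import Literature.MathematicalPhysics.QuantumLattice.HubbardHighTemperatureTwoPoint
import HarnessLib

/-!
# The pair-gap ceiling: `Δ_pair(L) = O(1/(c L²))` under uniform d-wave order

Obstruction report, Theorem 11 (part 2 of 2; part 1 is `SoloBlindPairTower`, the locality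
book-keeping is `SoloBlindPairFieldLocality`).

Part 1 gave, for a ground state `ψ` of `H = hubbardTorus 2 L t U` in the sector `(N, S^z = 0)` and
`Δ = pairField g L`,
`Δ_pair · (‖Δᴴψ‖² + ‖Δψ‖²) ≤ D - 2μ̄ (‖Δᴴψ‖² - ‖Δψ‖²)`, `D = re ⟨ψ,[Δ,[H,Δᴴ]]ψ⟩`.
Here LOCALITY bounds the right-hand side at the volume scale `L²` (not `L⁴`):

* `norm_doubleCommutator_pairField_le` — `‖[Δ,[H,Δᴴ]]‖ ≤ 57600 (2|t|+|U|) L²`, using the tree's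
  local-term decomposition `sum_hubbardTermOp`, `commute_hubbardTermOp_of_disjoint`,
  `card_filter_not_disjoint_hubbardTermSupp_le` (`FermionLiebRobinson`) and the even CAR
  subalgebras (`commute_of_mem_carEvenSubalgebra`, Bratteli–Robinson II §5.2.2);
* `pairGap_le_of_groundState_dWave_order` — **Theorem 11**: if a unit ground state `ψ` of the
  `(N, 0)` sector has `re ⟨Δ_dψ, Δ_dψ⟩ ≥ c L⁴` then
  `Δ_pair(H, N) ≤ (57600 (2|t|+|U|) + 1600 |μ̄|) / (c L²)`;
* `pairGap_bounded_of_hubbardSuperconductivity` — under the summit statement (via Theorem 1,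
  `uniform_dWave_bound_of_hubbardSuperconductivity`, and the uniform bound
  `|μ̄| ≤ 144(2|t|+|U|)` of `SoloBlindPairChemicalPotential`): for its `U, δ` there are `K, L₀`
  with `Δ_pair(L) ≤ K / L²` at every even `L ≥ L₀` in the doped sectors.

Requirement (R7) of the report: d-wave order at the summit's strength forces the `N ± 2` sector
ground energies to straddle `E₀(N)` linearly up to `O((1+|t|+|U|)/(cL²))` — three adjacent
particle-number sectors are locked together; equivalently the charge-`2` "tower" states
`Δᴴψ/‖Δᴴψ‖`, `Δψ/‖Δψ‖` are `O(1/(cL²))`-close in energy to the neighbouring sector floors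
(the pair-channel, `M = ±1` case of the Koma–Tasaki / Tasaki tower, J. Stat. Phys. 76 (1994)
745 and 174 (2019) 735, Thm. 3.1 — there stated for ONE-SITE order operators closing an su(2)
with the charge (assumptions (A2), (A3)); the d-wave pair field is a two-site, NON-su(2) order
operator, and the abstract `KomaTasakiSSB.horschVonDerLinden_holds` of the tree does not apply).
Conversely, any mechanism producing a pair gap `≫ 1/L²` uniformly (e.g. a parity/pairing gap of
BCS type at fixed `L`) is INCOMPATIBLE with the summit's order at that `L`.
Tags: [folklore] for the locality book-keeping, [this work] for the assembled ceilings.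
-/

namespace Summit.HubbardSuperconductivity.HubbardSuperconductivity.Theorems

open Matrix Finset Literature.MathematicalPhysics.QuantumLattice HubbardWave0 GaugeTwist
open Literature.Probability.LatticeModels (Torus.proj TorusSite)
open scoped ComplexConjugate ComplexOrder Matrix.Norms.L2Operator

namespace PairTower

section Torus

-- see `SoloBlindTwistAveraging`: synthesised vs landed `DecidableEq` instances on `Lex`
attribute [-instance] instDecidableEqLex

variable {L : ℕ} [NeZero L]

omit [NeZero L] in
/-- `hubbardTorus 2 L t U` is the sum of the tree's local terms (`μ = 0`). [folklore] -/
theorem hubbardTorus_eq_sum_hubbardTermOp (t U : ℝ) :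
    hubbardTorus 2 L t U = ∑ Z, hubbardTermOp (fermionTorusGraph 2 L) t U 0 Z := by
  rw [sum_hubbardTermOp, hamiltonianWith, Complex.ofReal_zero, zero_smul, sub_zero]
  rfl

omit [NeZero L] in
/-- The local terms have at most two sites. [folklore] -/
theorem card_hubbardTermSupp_le_two (Z : HubbardIdx (fermionTorusGraph 2 L)) :
    (hubbardTermSupp (fermionTorusGraph 2 L) Z).card ≤ 2 := by
  cases Z with
  | inl p => exact Finset.card_le_two
  | inr x => simp [hubbardTermSupp]

omit [NeZero L] in
/-- `‖h_Z‖ ≤ 2|t| + |U|` for the local terms at `μ = 0`. [folklore] -/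
theorem norm_hubbardTermOp_zero_le (t U : ℝ) (Z : HubbardIdx (fermionTorusGraph 2 L)) :
    ‖hubbardTermOp (fermionTorusGraph 2 L) t U 0 Z‖ ≤ 2 * |t| + |U| := by
  have h := norm_hubbardTermOp_le (fermionTorusGraph 2 L) t U 0 Z
  simpa using h

/-- **`‖[Δ_g, [H, Δ_gᴴ]]‖ ≤ 57600 (2|t| + |U|) L²`** for `H = hubbardTorus 2 L t U`, `|g| ≤ 1`:
the double commutator is of the order of the volume (locality of `H` and of `Δ_g`).
Hastings–Koma, CMP 265 (2006) App. A; Koma–Tasaki, J. Stat. Phys. 76 (1994) 745, (2.9).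
[this work] -/
theorem norm_doubleCommutator_pairField_le (t U : ℝ) (g : (Fin 2 → ℤ) → ℝ)
    (hg : ∀ e, |g e| ≤ 1) :
    ‖pairField g L * (hubbardTorus 2 L t U * (pairField g L)ᴴ -
          (pairField g L)ᴴ * hubbardTorus 2 L t U) -
        (hubbardTorus 2 L t U * (pairField g L)ᴴ - (pairField g L)ᴴ * hubbardTorus 2 L t U) *
          pairField g L‖ ≤ 57600 * (2 * |t| + |U|) * (L : ℝ) ^ 2 := by
  -- abbreviations
  set G := fermionTorusGraph 2 L with hG
  set hZ : HubbardIdx G → Matrix (Finset (Orb (FermionTorus 2 L)))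
      (Finset (Orb (FermionTorus 2 L))) ℂ := fun Z => hubbardTermOp G t U 0 Z with hhZ
  set F : Finset (HubbardIdx G × (TorusSite 2 L × (Fin 2 → ℤ))) :=
    (Finset.univ ×ˢ pairIdx L).filter fun zq =>
      ¬ Disjoint (hubbardTermSupp G zq.1) (pairSupp zq.2) with hF
  set b : HubbardIdx G × (TorusSite 2 L × (Fin 2 → ℤ)) →
      Matrix (Finset (Orb (FermionTorus 2 L))) (Finset (Orb (FermionTorus 2 L))) ℂ :=
    fun zq => hZ zq.1 * (pairOp g zq.2)ᴴ - (pairOp g zq.2)ᴴ * hZ zq.1 with hb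
  -- step 1: `[H, Δᴴ] = Σ_{(Z,q) ∈ F} [h_Z, a_qᴴ]`
  have hC : hubbardTorus 2 L t U * (pairField g L)ᴴ - (pairField g L)ᴴ * hubbardTorus 2 L t U =
      ∑ zq ∈ F, b zq := by
    rw [hubbardTorus_eq_sum_hubbardTermOp, pairField_conjTranspose_eq_sum]
    have h1 : (∑ Z, hubbardTermOp (fermionTorusGraph 2 L) t U 0 Z) * (∑ q ∈ pairIdx L, (pairOp g q)ᴴ) =
        ∑ Z, ∑ q ∈ pairIdx L, hZ Z * (pairOp g q)ᴴ := by
      rw [Finset.sum_mul]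
      exact Finset.sum_congr rfl fun Z _ => Finset.mul_sum _ _ _
    have h2 : (∑ q ∈ pairIdx L, (pairOp g q)ᴴ) * (∑ Z, hubbardTermOp (fermionTorusGraph 2 L) t U 0 Z) =
        ∑ Z, ∑ q ∈ pairIdx L, (pairOp g q)ᴴ * hZ Z := by
      rw [Finset.mul_sum]
      exact Finset.sum_congr rfl fun Z _ => Finset.sum_mul _ _ _
    rw [h1, h2, ← Finset.sum_sub_distrib]
    simp_rw [← Finset.sum_sub_distrib]
    rw [← Finset.sum_product' (f := fun Z q => hZ Z * (pairOp g q)ᴴ - (pairOp g q)ᴴ * hZ Z), hF,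
      ← Finset.sum_filter_add_sum_filter_not (Finset.univ ×ˢ pairIdx L)
        (fun zq => ¬ Disjoint (hubbardTermSupp G zq.1) (pairSupp zq.2))]
    rw [Finset.sum_eq_zero (s := (Finset.univ ×ˢ pairIdx L).filter fun zq =>
        ¬¬ Disjoint (hubbardTermSupp G zq.1) (pairSupp zq.2)) (fun zq hzq => ?_), add_zero]
    rw [Finset.mem_filter, not_not] at hzq
    exact sub_eq_zero.2 (commute_hubbardTermOp_of_disjoint G t U 0 zq.1
      (carEvenSubalgebra_le_carSubalgebra _ (pairOp_conjTranspose_mem_carEvenSubalgebra g zq.2))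
      hzq.2).eq
  -- step 2: the abstract book-keeping
  rw [hC, pairField_eq_sum_pairOp]
  have hβ0 : (0 : ℝ) ≤ 2 * (2 * |t| + |U|) * 2 := by positivity
  have h := norm_commutator_sum_le (pairIdx L) F (pairOp g) b
    (fun p zq => ¬ Disjoint (pairSupp p) (hubbardTermSupp G zq.1 ∪ pairSupp zq.2))
    (α := 2) (β := fun _ => 2 * (2 * |t| + |U|) * 2) (m := 40) (by norm_num) (fun _ _ => hβ0)
    ?_ (fun p _ => norm_pairOp_le g hg p) ?_ ?_
  · refine h.trans ?_
    rw [Finset.sum_const, nsmul_eq_mul]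
    -- `|F| ≤ 90 L²`
    have hFcard : (F.card : ℝ) ≤ 90 * (L : ℝ) ^ 2 := by
      have hnat : F.card ≤ 18 * (pairIdx L).card := by
        rw [hF, Finset.card_eq_sum_ones, Finset.sum_filter, Finset.sum_product_right]
        calc ∑ q ∈ pairIdx L, ∑ Z ∈ (Finset.univ : Finset (HubbardIdx G)),
              (if ¬ Disjoint (hubbardTermSupp G (Z, q).1) (pairSupp (Z, q).2) then 1 else 0)
            ≤ ∑ _q ∈ pairIdx L, 18 := by
              refine Finset.sum_le_sum fun q _ => ?_
              rw [Finset.sum_boole, Nat.cast_id]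
              refine (card_filter_not_disjoint_hubbardTermSupp_le G (Δ := 4)
                (fun x => SourceGas.card_filter_fermionTorusGraph_adj_le x) (pairSupp q)).trans ?_
              have := card_pairSupp_le (L := L) q
              nlinarith
          _ = 18 * (pairIdx L).card := by rw [Finset.sum_const, smul_eq_mul, mul_comm]
      have hc := card_pairIdx_le (L := L)
      calc (F.card : ℝ) ≤ 18 * (pairIdx L).card := by exact_mod_cast hnat
        _ ≤ 18 * (5 * (L : ℝ) ^ 2) := by nlinarith
        _ = 90 * (L : ℝ) ^ 2 := by ring
    have htU : 0 ≤ 2 * |t| + |U| := by positivity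
    have key := mul_le_mul_of_nonneg_right hFcard htU
    push_cast
    nlinarith [key, hFcard, htU]
  · -- graded locality: `a_p` commutes with `[h_Z, a_qᴴ]` off the joint support
    intro p _ zq _ hpz
    have hdis : Disjoint (pairSupp p) (hubbardTermSupp G zq.1 ∪ pairSupp zq.2) := not_not.1 hpz
    have hmemZ : hZ zq.1 ∈ carSubalgebra (orbSet (hubbardTermSupp G zq.1 ∪ pairSupp zq.2)) :=
      carSubalgebra_mono (orbSet_mono Finset.subset_union_left)
        (carEvenSubalgebra_le_carSubalgebra _ (hubbardTermOp_mem_carEvenSubalgebra G t U 0 zq.1))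
    have hmemq : (pairOp g zq.2)ᴴ ∈
        carSubalgebra (orbSet (hubbardTermSupp G zq.1 ∪ pairSupp zq.2)) :=
      carSubalgebra_mono (orbSet_mono Finset.subset_union_right)
        (carEvenSubalgebra_le_carSubalgebra _ (pairOp_conjTranspose_mem_carEvenSubalgebra g zq.2))
    exact commute_of_mem_carEvenSubalgebra (pairOp_mem_carEvenSubalgebra g p)
      (Subalgebra.sub_mem _ (Subalgebra.mul_mem _ hmemZ hmemq) (Subalgebra.mul_mem _ hmemq hmemZ))
      (disjoint_orbSet hdis)
  · -- `‖[h_Z, a_qᴴ]‖ ≤ 2 ‖h_Z‖ ‖a_q‖ ≤ 2 (2|t|+|U|) 2`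
    intro zq _
    have h1 := norm_hubbardTermOp_zero_le (L := L) t U zq.1
    have h2 := norm_pairOp_conjTranspose_le g hg zq.2
    calc ‖hZ zq.1 * (pairOp g zq.2)ᴴ - (pairOp g zq.2)ᴴ * hZ zq.1‖
        ≤ ‖hZ zq.1‖ * ‖(pairOp g zq.2)ᴴ‖ + ‖(pairOp g zq.2)ᴴ‖ * ‖hZ zq.1‖ :=
          (norm_sub_le _ _).trans (add_le_add (norm_mul_le _ _) (norm_mul_le _ _))
      _ ≤ (2 * |t| + |U|) * 2 + 2 * (2 * |t| + |U|) :=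
          add_le_add (mul_le_mul h1 h2 (norm_nonneg _) (by positivity))
            (mul_le_mul h2 h1 (norm_nonneg _) (by norm_num))
      _ = 2 * (2 * |t| + |U|) * 2 := by ring
  · -- at most `40` pair terms meet the (≤ 4)-site joint support
    intro zq _
    refine (card_filter_pairIdx_le _).trans ?_
    have hu := Finset.card_union_le (hubbardTermSupp G zq.1) (pairSupp zq.2)
    have h1 : (hubbardTermSupp G zq.1).card ≤ 2 := card_hubbardTermSupp_le_two zq.1
    have h2 : (pairSupp zq.2).card ≤ 2 := card_pairSupp_le zq.2
    omega

/-! ### Theorem 11: the pair-gap ceiling -/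

/-- **Theorem 11 (pair-gap ceiling under d-wave order).** Let `ψ` be a unit ground state of
`H = hubbardTorus 2 L t U` in the sector `(N, S^z = 0)` with d-wave order
`re ⟨Δ_dψ, Δ_dψ⟩ ≥ c L⁴`, `c > 0`. Then the pair gap
`Δ_pair = ½[E₀(N+2) + E₀(N-2) - 2E₀(N)]` (sector energies at `S^z = 0`) obeys
`Δ_pair ≤ (57600 (2|t|+|U|) + 1600 |μ̄|) / (c L²)`, `μ̄ = ¼[E₀(N+2) - E₀(N-2)]`.
Koma–Tasaki, J. Stat. Phys. 76 (1994) 745, Thm. 2.2 (pair channel, finite volume);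
Lin–Hirsch–Scalapino, PRB 37 (1988) 7359, eq. (9). [this work] -/
theorem pairGap_le_of_groundState_dWave_order (t U : ℝ) {c : ℝ} (hc : 0 < c) {N : ℕ}
    {ψ : Fock (Orb (FermionTorus 2 L))} (hψ1 : star ψ ⬝ᵥ ψ = 1)
    (hgs : IsGroundStateInSector (hubbardTorus 2 L t U) N 0 ψ)
    (hord : c * (L : ℝ) ^ 4 ≤ (star (pairField dWaveFormFactor L *ᵥ ψ) ⬝ᵥ
      (pairField dWaveFormFactor L *ᵥ ψ)).re) :
    pairGap (hubbardTorus 2 L t U) N ≤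
      (57600 * (2 * |t| + |U|) + 1600 * |pairChemicalPotential (hubbardTorus 2 L t U) N|) /
        (c * (L : ℝ) ^ 2) := by
  set H := hubbardTorus 2 L t U with hH
  set Δ := pairField dWaveFormFactor L with hΔ
  set a : ℝ := (star (Δᴴ *ᵥ ψ) ⬝ᵥ (Δᴴ *ᵥ ψ)).re with ha
  set bb : ℝ := (star (Δ *ᵥ ψ) ⬝ᵥ (Δ *ᵥ ψ)).re with hbb
  set D : ℝ := (star ψ ⬝ᵥ (Δ * (H * Δᴴ - Δᴴ * H) - (H * Δᴴ - Δᴴ * H) * Δ) *ᵥ ψ).re with hD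
  set μ := pairChemicalPotential H N with hμ
  set gap := pairGap H N with hgap
  have hmain : gap * (a + bb) ≤ D - 2 * μ * (a - bb) := pairGap_mul_le t U dWaveFormFactor hgs
  -- `‖ψ‖ = 1`
  have hnorm : ‖(WithLp.toLp 2 ψ : EuclideanSpace ℂ (Finset (Orb (FermionTorus 2 L))))‖ ^ 2 = 1 := by
    rw [ThermodynamicLimit.norm_toLp_sq, hψ1, Complex.one_re]
  -- the two locality bounds
  have hDle : D ≤ 57600 * (2 * |t| + |U|) * (L : ℝ) ^ 2 := by
    have h := abs_re_expect_le_norm_mul (Δ * (H * Δᴴ - Δᴴ * H) - (H * Δᴴ - Δᴴ * H) * Δ) ψ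
    rw [hnorm, mul_one] at h
    exact (le_abs_self _).trans (h.trans
      (norm_doubleCommutator_pairField_le t U dWaveFormFactor abs_dWaveFormFactor_le_one))
  have hκ : |a - bb| ≤ 800 * (L : ℝ) ^ 2 := by
    rw [ha, hbb, re_self_conjTranspose_sub]
    have h := abs_re_expect_le_norm_mul (Δ * Δᴴ - Δᴴ * Δ) ψ
    rw [hnorm, mul_one] at h
    exact h.trans
      (norm_commutator_pairField_conjTranspose_le dWaveFormFactor abs_dWaveFormFactor_le_one)
  -- nonnegativity of `a`, the order lower bound on `bb`
  have ha0 : 0 ≤ a := (Complex.nonneg_iff.mp (dotProduct_star_self_nonneg _)).1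
  have hLpos : (0 : ℝ) < L := by exact_mod_cast Nat.pos_of_ne_zero (NeZero.ne L)
  have hL2 : 0 < c * (L : ℝ) ^ 2 := by positivity
  have hsum : c * (L : ℝ) ^ 4 ≤ a + bb := by linarith
  -- the right-hand side of the tower inequality
  have hR : D - 2 * μ * (a - bb) ≤
      (57600 * (2 * |t| + |U|) + 1600 * |μ|) * (L : ℝ) ^ 2 := by
    have h1 : -(2 * μ * (a - bb)) ≤ 2 * |μ| * |a - bb| := by
      have e : |2 * μ * (a - bb)| = 2 * |μ| * |a - bb| := by
        rw [abs_mul, abs_mul, abs_two]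
      have := neg_abs_le (2 * μ * (a - bb))
      linarith
    have h2 : 2 * |μ| * |a - bb| ≤ 2 * |μ| * (800 * (L : ℝ) ^ 2) :=
      mul_le_mul_of_nonneg_left hκ (by positivity)
    linarith
  rw [le_div_iff₀ hL2]
  by_cases hg : gap ≤ 0
  · have : 0 ≤ (57600 * (2 * |t| + |U|) + 1600 * |μ|) := by positivity
    nlinarith
  · rw [not_le] at hg
    calc gap * (c * (L : ℝ) ^ 2) ≤ gap * (a + bb) / (L : ℝ) ^ 2 := by
          rw [le_div_iff₀ (pow_pos hLpos 2), mul_assoc]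
          refine mul_le_mul_of_nonneg_left ?_ hg.le
          calc c * (L : ℝ) ^ 2 * (L : ℝ) ^ 2 = c * (L : ℝ) ^ 4 := by ring
            _ ≤ a + bb := hsum
      _ ≤ (57600 * (2 * |t| + |U|) + 1600 * |μ|) * (L : ℝ) ^ 2 / (L : ℝ) ^ 2 :=
          div_le_div_of_nonneg_right (hmain.trans hR) (pow_pos hLpos 2).le
      _ = 57600 * (2 * |t| + |U|) + 1600 * |μ| := by
          rw [mul_div_assoc, div_self (pow_ne_zero 2 hLpos.ne'), mul_one]

/-- **The summit forces a vanishing pair gap.** If `HubbardSuperconductivity` holds, then for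
its `U, δ` there are `K : ℝ` and `L₀` such that at every even side `L = n+1 ≥ L₀` the pair gap of
the doped `S^z = 0` sector `N_L = 2⌊(1-δ)L²/2⌋` satisfies
`pairGap (hubbardTorus 2 L 1 U) N_L ≤ K / L²`: the sector energies `E₀(N_L ± 2)` straddle
`E₀(N_L)` linearly up to `O(1/L²)`. Theorem 11 with the uniform bound
`|μ̄| ≤ 144(2 + |U|)` (`abs_pairChemicalPotential_le`) and Theorem 1
(`uniform_dWave_bound_of_hubbardSuperconductivity`). Koma–Tasaki (1994) Thm. 2.2 /
Tasaki (2019) Thm. 3.1, pair channel. [this work] -/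
theorem pairGap_bounded_of_hubbardSuperconductivity (hS : HubbardSuperconductivity) :
    ∃ U : ℝ, 0 < U ∧ ∃ δ ∈ Set.Ioo (0 : ℝ) (1 / 2), ∃ K : ℝ, ∃ L₀ : ℕ,
      ∀ n : ℕ, Even (n + 1) → L₀ ≤ n + 1 →
        pairGap (hubbardTorus 2 (n + 1) 1 U) (2 * ⌊(1 - δ) * ((n + 1 : ℕ) : ℝ) ^ 2 / 2⌋₊) ≤
          K / ((n + 1 : ℕ) : ℝ) ^ 2 := by
  obtain ⟨U, hU, δ, hδ, c, hc, L₀, hb⟩ := uniform_dWave_bound_of_hubbardSuperconductivity hS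
  refine ⟨U, hU, δ, hδ, (57600 * (2 * |(1 : ℝ)| + |U|) + 1600 * (144 * (2 * |(1 : ℝ)| + |U|))) / c,
    max (max L₀ 4) ⌈2 / δ⌉₊, fun n hn hL => ?_⟩
  have hL₀ : L₀ ≤ n + 1 := le_trans (le_trans (le_max_left _ _) (le_max_left _ _)) hL
  have hL4 : 4 ≤ n + 1 := le_trans (le_trans (le_max_right _ _) (le_max_left _ _)) hL
  have hLδ : ⌈2 / δ⌉₊ ≤ n + 1 := le_trans (le_max_right _ _) hL
  obtain ⟨ψ, hψ1, hψ⟩ :=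
    InfVolFermionState.exists_unit_isGroundStateInSector_rectN (1 : ℝ) U (n := 1 - δ)
      (by linarith [hδ.1]) (n + 1)
  have hψ' : IsGroundStateInSector (hubbardTorus 2 (n + 1) 1 U)
      (2 * ⌊(1 - δ) * ((n + 1 : ℕ) : ℝ) ^ 2 / 2⌋₊) 0 ψ := by
    simpa [ThermodynamicLimit.rectN] using hψ
  have hord := hb n hn hL₀ ψ hψ1 hψ'
  rw [PosSemidefTrace.expect_conjTranspose_mul] at hord
  -- the filling: `⌊(1-δ)L²/2⌋ = m + 1` with `2m + 4 ≤ L² ≤ 4(2m+1)`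
  set Lr : ℝ := ((n + 1 : ℕ) : ℝ) with hLr
  have hLr4 : (4 : ℝ) ≤ Lr := by rw [hLr]; exact_mod_cast hL4
  have hLr2 : (16 : ℝ) ≤ Lr ^ 2 := by nlinarith
  have hx0 : (0 : ℝ) ≤ (1 - δ) * Lr ^ 2 / 2 := by
    have : 0 ≤ 1 - δ := by linarith [hδ.2]
    positivity
  have hfl := Nat.floor_le hx0
  have hlt := Nat.lt_floor_add_one ((1 - δ) * Lr ^ 2 / 2)
  have hn₀ : 1 ≤ ⌊(1 - δ) * Lr ^ 2 / 2⌋₊ := by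
    refine Nat.le_floor ?_
    push_cast
    rw [le_div_iff₀ (by norm_num : (0 : ℝ) < 2)]
    nlinarith [hδ.2]
  obtain ⟨m, hm⟩ := Nat.exists_eq_add_of_le' hn₀
  have hmR : ((m : ℝ) + 1) = (⌊(1 - δ) * Lr ^ 2 / 2⌋₊ : ℝ) := by
    rw [hm]; push_cast; ring
  have hδL : 2 ≤ δ * Lr ^ 2 := by
    have h1 : (2 / δ : ℝ) ≤ Lr := by
      rw [hLr]; exact le_trans (Nat.le_ceil _) (by exact_mod_cast hLδ)
    have h2 : 2 ≤ δ * Lr := by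
      have := mul_le_mul_of_nonneg_left h1 hδ.1.le
      rwa [mul_div_cancel₀ _ hδ.1.ne'] at this
    nlinarith [hδ.1]
  have hmL : 2 * m + 4 ≤ (n + 1) ^ 2 := by
    have : (2 * m + 4 : ℝ) ≤ Lr ^ 2 := by nlinarith
    rw [hLr] at this
    exact_mod_cast this
  have hlow : (n + 1) ^ 2 ≤ 4 * (2 * m + 1) := by
    have : Lr ^ 2 ≤ 4 * (2 * (m : ℝ) + 1) := by nlinarith [hδ.2]
    rw [hLr] at this
    exact_mod_cast this
  rw [hm, show 2 * (m + 1) = 2 * m + 2 by ring] at hψ' ⊢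
  have h := pairGap_le_of_groundState_dWave_order 1 U hc hψ1 hψ' hord
  have hμ := abs_pairChemicalPotential_le (L := n + 1) 1 U m hmL hlow
  refine h.trans ?_
  have hLpos : (0 : ℝ) < Lr ^ 2 := by positivity
  rw [← hLr, div_le_div_iff₀ (by positivity) hLpos]
  have hK : 0 ≤ 57600 * (2 * |(1 : ℝ)| + |U|) := by positivity
  calc (57600 * (2 * |(1 : ℝ)| + |U|) +
          1600 * |pairChemicalPotential (hubbardTorus 2 (n + 1) 1 U) (2 * m + 2)|) * Lr ^ 2
      ≤ (57600 * (2 * |(1 : ℝ)| + |U|) + 1600 * (144 * (2 * |(1 : ℝ)| + |U|))) * Lr ^ 2 := by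
        refine mul_le_mul_of_nonneg_right ?_ hLpos.le
        linarith
    _ = (57600 * (2 * |(1 : ℝ)| + |U|) + 1600 * (144 * (2 * |(1 : ℝ)| + |U|))) / c *
          (c * Lr ^ 2) := by
        field_simp

end Torus

end PairTower

end Summit.HubbardSuperconductivity.HubbardSuperconductivity.Theorems
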